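import Summits.NavierStokesRegularity.OSWSelfSimilar.SheetRProfileRegularity
import Summits.NavierStokesRegularity.OSWSelfSimilar.SheetRWeightedGain
import Summits.NavierStokesRegularity.OSWSelfSimilar.SheetRTimeShiftMode
import HarnessLib

/-!
# SHEET-ℝ: the T-shift mode of an energy-class profile lies in the energy space — item (P6) of the Z3-SR-SPEC
# spectral certificate, assembled

HONEST FRAMING (cell ns-blowup GROUP B / zone Z3, case Z3-SR-SPEC, PREREG-SHEET-R-SPEC P4 (ii) item (P6); 1-D MODEL — the
viscous gCLM / OSW sheet-ℝ profile equation; not Euler, not NS; «violates: none — MODEL»). Nothing here asserts that a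
profile exists: every theorem is an implication from a strong (or `E`-weak) zero.

ITEM (P6) of `CertificateViscousSheetRSpectrum`: «`σ = 1` is an eigenvalue of `−DG(Ω*)` with eigenvector `Ω* + ½ξΩ*′ ∈ E`»,
`E = odd H¹_{L²+ξ²}` (`L = 8`). (P6a), the pointwise identity `DG(Ω)[v] = −v` at a `C³` strong zero in the decay class
`Ω, ξΩ′ ∈ L¹`, `|Ω″| ≤ M`, `|Ω′| ≤ C/(1+ξ²)`, is `SheetRTimeShiftMode.linearised_timeShiftMode_eq_neg`. THIS FILE proves (P6b)
and discharges that decay class for the data shape the certificate delivers after the weak→strong bridge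
(`SheetRWeakToStrong`): an ODD `C²` pointwise zero of `Ω + ½ξΩ′ + a·𝒰Ω·Ω′ − HΩ·Ω − νΩ″` (`ν > 0`) with
`∫(L²+ξ²)Ω² < ∞`, `∫(L²+ξ²)Ω′² < ∞`.
ROUTE (every step a tree theorem): `Ψ = Ω′ ∈ C²` solves `νΨ″ = (½ξ + a𝒰Ω)Ψ′ + (3/2 + (a−1)HΩ)Ψ − H[Ω′]Ω`
(`SheetRProfileRegularity.deriv_three_eq`); `SheetRWeightedGain.weighted_gain` at `k = 0` (`δ = 3/4`) and `k = 1`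
(`δ = 1/4`) with `b = a𝒰Ω`, `c = (a−1)HΩ` (tail smallness from `HΩ → 0`), source `g = −H[Ω′]Ω ∈ L²_{(1+ξ²)²}`, level-0
start `Ω′, Ω″ ∈ L²` gives `∫(1+ξ²)²(Ω′² + Ω″²) < ∞` (`weighted_level_two`); hence `v = Ω + ½ξΩ′` is odd with
`∫(L²+ξ²)(v² + v′²) < ∞` (`timeShiftMode_mem_energyClass`), and Agmon on `Ω″`, `(1+ξ²)Ω′ ∈ H¹` gives the decay class
— the latter in the companion `SheetRTimeShiftModeAssembly` (`decayClass`, `timeShiftMode_eigen_and_energy` = (P6a) ∧ (P6b),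
`…_of_weakZero` = the same on the `E`-weak zero `Ω = ∫₀Ω₁`). [folklore] 1-D weighted a priori calculus; MODEL-support, no NS
content; no number of any certificate moves.
-/

noncomputable section

namespace Summit.NavierStokesRegularity.OSWSelfSimilar
namespace SheetRTimeShiftModeEnergy

open _root_.MeasureTheory _root_.Set _root_.Filter Literature.Analysis.Fourier SheetRWeakProfilePV
  SheetRProfileRegularity
open scoped Real Topology ENNReal ContDiff

variable {a ν L : ℝ} {Ω : ℝ → ℝ}

/-! ### §1 The weighted source term -/

/-- The source weight: `(1+ξ²)²(H[Ω′]·Ω)² ∈ L¹` from `sup(1+ξ²)Ω² < ∞` and `(1+ξ²)(H[Ω′])² ∈ L¹`. [folklore] -/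
theorem integrable_source_sq (hL : 0 < L) (hΩ : ContDiff ℝ 2 Ω) (hodd : ∀ y, Ω (-y) = -Ω y)
    (hw0 : Integrable fun y => (L ^ 2 + y ^ 2) * Ω y ^ 2)
    (hw1 : Integrable fun y => (L ^ 2 + y ^ 2) * deriv Ω y ^ 2) :
    Integrable fun ξ => (1 + ξ ^ 2) ^ 2 * (hilbertTransform (deriv Ω) ξ * Ω ξ) ^ 2 := by
  obtain ⟨-, -, -, -, hH'c, hH'2, hxH'⟩ := hilbert_basic hL hΩ hodd hw0 hw1
  obtain ⟨S, -, -, hS, -, -⟩ := exists_bounds hL hΩ hodd hw0 hw1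
  have hS0 : 0 ≤ S := le_trans (by positivity) (hS 0)
  have hI : Integrable fun ξ => S * (hilbertTransform (deriv Ω) ξ ^ 2 + (ξ * hilbertTransform (deriv Ω) ξ) ^ 2) :=
    (hH'2.integrable_sq.add hxH'.integrable_sq).const_mul S
  have hm : AEStronglyMeasurable (fun ξ => (1 + ξ ^ 2) ^ 2 * (hilbertTransform (deriv Ω) ξ * Ω ξ) ^ 2) volume :=
    Continuous.aestronglyMeasurable (by have := hΩ.continuous; fun_prop)
  refine hI.mono' hm (Eventually.of_forall fun ξ => ?_)
  rw [Real.norm_eq_abs, abs_of_nonneg (by positivity)]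
  have h1 := hS ξ
  have h2 : 0 ≤ (1 + ξ ^ 2) * hilbertTransform (deriv Ω) ξ ^ 2 := by positivity
  calc (1 + ξ ^ 2) ^ 2 * (hilbertTransform (deriv Ω) ξ * Ω ξ) ^ 2
      = ((1 + ξ ^ 2) * Ω ξ ^ 2) * ((1 + ξ ^ 2) * hilbertTransform (deriv Ω) ξ ^ 2) := by ring
    _ ≤ S * ((1 + ξ ^ 2) * hilbertTransform (deriv Ω) ξ ^ 2) := by gcongr
    _ = S * (hilbertTransform (deriv Ω) ξ ^ 2 + (ξ * hilbertTransform (deriv Ω) ξ) ^ 2) := by ring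

/-! ### §2 One step of the weighted gain for `Ψ = Ω′` -/

/-- **Gain step for `Ψ = Ω′`.** For an odd energy-class `C²` strong zero (`ν > 0`), if `∫(1+ξ²)^k(Ω′² + Ω″²) < ∞` with
`k ≤ 1` and `3/2 = δ + (2k+3)/4`, `δ > 0`, then `∫(1+ξ²)^{k+1}(Ω′² + Ω″²) < ∞` — `SheetRWeightedGain.weighted_gain` for
`νΨ″ = (½ξ + a𝒰Ω)Ψ′ + (3/2 + (a−1)HΩ)Ψ − H[Ω′]Ω` with the bounds of `SheetRProfileRegularity` (tail smallness from
`HΩ → 0`). MODEL statement; not NS. [folklore] -/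
theorem gain_step (hL : 0 < L) (hν : 0 < ν) (hΩ : ContDiff ℝ 2 Ω) (hodd : ∀ y, Ω (-y) = -Ω y)
    (hw0 : Integrable fun y => (L ^ 2 + y ^ 2) * Ω y ^ 2)
    (hw1 : Integrable fun y => (L ^ 2 + y ^ 2) * deriv Ω y ^ 2)
    (hG : ∀ X, Ω X + 1 / 2 * X * deriv Ω X + a * (∫ s in (0 : ℝ)..X, hilbertTransform Ω s) * deriv Ω X
      - hilbertTransform Ω X * Ω X - ν * iteratedDeriv 2 Ω X = 0)
    {k : ℕ} {δ : ℝ} (hk : k ≤ 1) (hδ : 0 < δ) (hκ : (3 / 2 : ℝ) = δ + (2 * k + 3) / 4)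
    (hΨk : Integrable fun ξ => (1 + ξ ^ 2) ^ k * deriv Ω ξ ^ 2)
    (hΨ'k : Integrable fun ξ => (1 + ξ ^ 2) ^ k * deriv (deriv Ω) ξ ^ 2) :
    (Integrable fun ξ => (1 + ξ ^ 2) ^ (k + 1) * deriv Ω ξ ^ 2) ∧
      Integrable fun ξ => (1 + ξ ^ 2) ^ (k + 1) * deriv (deriv Ω) ξ ^ 2 := by
  have hν0 : ν ≠ 0 := hν.ne'
  have hΩ3 := contDiff_three hL hν0 hΩ hw0 hw1 hG
  obtain ⟨hH1, hHd, -, -, hH'c, -, -⟩ := hilbert_basic hL hΩ hodd hw0 hw1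
  obtain ⟨S, B, U₀, -, hB, hU⟩ := exists_bounds hL hΩ hodd hw0 hw1
  have hHc := hH1.continuous
  have hΨ : ContDiff ℝ 2 (deriv Ω) := (contDiff_succ_iff_deriv.1 (hΩ3 : ContDiff ℝ (2 + 1) Ω)).2.2
  have hUd : ∀ X, HasDerivAt (fun Y => ∫ s in (0 : ℝ)..Y, hilbertTransform Ω s) (hilbertTransform Ω X) X :=
    velocity_hasDerivAt hHc
  -- coefficients
  have hb : ContDiff ℝ 1 (fun ξ => a * ∫ s in (0 : ℝ)..ξ, hilbertTransform Ω s) :=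
    contDiff_const.mul (velocity_contDiff_one hHc)
  have hbd : deriv (fun ξ => a * ∫ s in (0 : ℝ)..ξ, hilbertTransform Ω s) = fun ξ => a * hilbertTransform Ω ξ :=
    funext fun ξ => ((hUd ξ).const_mul a).deriv
  have hc : Continuous (fun ξ => (a - 1) * hilbertTransform Ω ξ) := continuous_const.mul hHc
  have hg : Continuous (fun ξ => -(hilbertTransform (deriv Ω) ξ * Ω ξ)) := (hH'c.mul hΩ.continuous).neg
  have hEq : ∀ ξ, ν * deriv (deriv (deriv Ω)) ξ =
      (ξ / 2 + a * ∫ s in (0 : ℝ)..ξ, hilbertTransform Ω s) * deriv (deriv Ω) ξ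
        + (3 / 2 + (a - 1) * hilbertTransform Ω ξ) * deriv Ω ξ + -(hilbertTransform (deriv Ω) ξ * Ω ξ) :=
    deriv_three_eq hL hν0 hΩ hodd hw0 hw1 hG
  -- the weighted source
  have hsrc := integrable_source_sq hL hΩ hodd hw0 hw1
  have hgk : Integrable fun ξ => (1 + ξ ^ 2) ^ (k + 1) * (-(hilbertTransform (deriv Ω) ξ * Ω ξ)) ^ 2 := by
    have hm : AEStronglyMeasurable
        (fun ξ => (1 + ξ ^ 2) ^ (k + 1) * (-(hilbertTransform (deriv Ω) ξ * Ω ξ)) ^ 2) volume :=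
      Continuous.aestronglyMeasurable (by have := hΩ.continuous; fun_prop)
    refine hsrc.mono' hm (Eventually.of_forall fun ξ => ?_)
    rw [Real.norm_eq_abs, abs_of_nonneg (by positivity), neg_sq]
    have h1 : (1 : ℝ) ≤ 1 + ξ ^ 2 := by nlinarith [sq_nonneg ξ]
    have hpow : (1 + ξ ^ 2) ^ (k + 1) ≤ (1 + ξ ^ 2) ^ 2 := pow_le_pow_right₀ h1 (by omega)
    exact mul_le_mul_of_nonneg_right hpow (sq_nonneg _)
  -- bounds and tail smallness
  have hB₀ : ∀ ξ, |a * ∫ s in (0 : ℝ)..ξ, hilbertTransform Ω s| ≤ |a| * U₀ := fun ξ => by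
    rw [abs_mul]; exact mul_le_mul_of_nonneg_left (hU ξ) (abs_nonneg a)
  have hB₁ : ∀ ξ, |deriv (fun ξ => a * ∫ s in (0 : ℝ)..ξ, hilbertTransform Ω s) ξ| ≤ |a| * B := fun ξ => by
    rw [hbd]; simp only; rw [abs_mul]; exact mul_le_mul_of_nonneg_left (hB ξ) (abs_nonneg a)
  have hC₀ : ∀ ξ, |(a - 1) * hilbertTransform Ω ξ| ≤ |a - 1| * B := fun ξ => by
    rw [abs_mul]; exact mul_le_mul_of_nonneg_left (hB ξ) (abs_nonneg _)
  have hApos : 0 < |a| / 2 + |a - 1| + 1 := by positivity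
  obtain ⟨R, hR⟩ := hilbert_small hL hΩ hodd hw0 hw1 (ε := δ / (4 * (|a| / 2 + |a - 1| + 1))) (by positivity)
  have htail : ∀ ξ, R ≤ |ξ| →
      |deriv (fun ξ => a * ∫ s in (0 : ℝ)..ξ, hilbertTransform Ω s) ξ| / 2 + |(a - 1) * hilbertTransform Ω ξ|
        ≤ δ / 4 := fun ξ hξ => by
    rw [hbd]; simp only; rw [abs_mul, abs_mul]
    have h := hR ξ hξ
    have hH0 : 0 ≤ |hilbertTransform Ω ξ| := abs_nonneg _
    calc |a| * |hilbertTransform Ω ξ| / 2 + |a - 1| * |hilbertTransform Ω ξ|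
        = (|a| / 2 + |a - 1|) * |hilbertTransform Ω ξ| := by ring
      _ ≤ (|a| / 2 + |a - 1| + 1) * (δ / (4 * (|a| / 2 + |a - 1| + 1))) :=
          mul_le_mul (by linarith) h hH0 hApos.le
      _ = δ / 4 := by field_simp
  exact SheetRWeightedGain.weighted_gain (Ψ := deriv Ω)
    (b := fun ξ => a * ∫ s in (0 : ℝ)..ξ, hilbertTransform Ω s)
    (c := fun ξ => (a - 1) * hilbertTransform Ω ξ) (g := fun ξ => -(hilbertTransform (deriv Ω) ξ * Ω ξ))
    hν hδ hκ hΨ hb hc hg hEq hΨk hΨ'k hgk hB₀ hB₁ hC₀ htail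

/-- **Two levels gained.** For an odd energy-class `C²` strong zero (`ν > 0`): `∫(1+ξ²)²Ω′² < ∞` and `∫(1+ξ²)²Ω″² < ∞`
(`gain_step` at `k = 0`, `δ = 3/4`, then `k = 1`, `δ = 1/4`; the level-0 start is `Ω′, Ω″ ∈ L²`). MODEL statement;
not NS. [folklore] -/
theorem weighted_level_two (hL : 0 < L) (hν : 0 < ν) (hΩ : ContDiff ℝ 2 Ω) (hodd : ∀ y, Ω (-y) = -Ω y)
    (hw0 : Integrable fun y => (L ^ 2 + y ^ 2) * Ω y ^ 2)
    (hw1 : Integrable fun y => (L ^ 2 + y ^ 2) * deriv Ω y ^ 2)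
    (hG : ∀ X, Ω X + 1 / 2 * X * deriv Ω X + a * (∫ s in (0 : ℝ)..X, hilbertTransform Ω s) * deriv Ω X
      - hilbertTransform Ω X * Ω X - ν * iteratedDeriv 2 Ω X = 0) :
    (Integrable fun ξ => (1 + ξ ^ 2) ^ 2 * deriv Ω ξ ^ 2) ∧
      Integrable fun ξ => (1 + ξ ^ 2) ^ 2 * deriv (deriv Ω) ξ ^ 2 := by
  have hΩ1 : ContDiff ℝ 1 Ω := hΩ.of_le (by norm_num)
  obtain ⟨-, -, -, hΩ'2, -, -⟩ := basic hL hΩ1 hw0 hw1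
  have hΩ''2 := memLp_two_deriv_two hL hν.ne' hΩ hodd hw0 hw1 hG
  have h0 : Integrable fun ξ => (1 + ξ ^ 2) ^ 0 * deriv Ω ξ ^ 2 := by
    simp only [pow_zero, one_mul]; exact hΩ'2.integrable_sq
  have h0' : Integrable fun ξ => (1 + ξ ^ 2) ^ 0 * deriv (deriv Ω) ξ ^ 2 := by
    simp only [pow_zero, one_mul]; exact hΩ''2.integrable_sq
  obtain ⟨h1, h1'⟩ := gain_step hL hν hΩ hodd hw0 hw1 hG (k := 0) (δ := 3 / 4) zero_le_one (by norm_num)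
    (by norm_num) h0 h0'
  exact gain_step hL hν hΩ hodd hw0 hw1 hG (k := 1) (δ := 1 / 4) le_rfl (by norm_num) (by norm_num) h1 h1'

/-! ### §3 The T-shift mode lies in the energy class -/

/-- The derivative of an odd differentiable function is even. [folklore] -/
theorem deriv_even_of_odd (hodd : ∀ y, Ω (-y) = -Ω y) (y : ℝ) : deriv Ω (-y) = deriv Ω y := by
  have h : (fun x => Ω (-x)) = fun x => -Ω x := funext hodd
  have h1 : deriv (fun x => Ω (-x)) y = -deriv Ω (-y) := deriv_comp_neg Ω y
  rw [h, deriv.fun_neg] at h1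
  linarith

/-- **(P6b) The T-shift mode is in `E`.** For an odd energy-class `C²` strong zero of the sheet-ℝ profile map (`ν > 0`,
`L > 0`), the T-shift mode `v = Ω + ½ξΩ′` is odd and satisfies `∫(L²+ξ²)v² < ∞`, `∫(L²+ξ²)v′² < ∞` — i.e.
`v ∈ E = odd H¹_{L²+ξ²}` (for the certificate: `L = 8`, `‖v‖²_E = ∫(64+ξ²)(v′² + ¼v²) < ∞`). Second half of item (P6)
of the Z3-SR-SPEC spectral certificate. MODEL statement; not NS; no number of any certificate moves. [folklore] -/
theorem timeShiftMode_mem_energyClass {v : ℝ → ℝ} (hL : 0 < L) (hν : 0 < ν) (hΩ : ContDiff ℝ 2 Ω)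
    (hodd : ∀ y, Ω (-y) = -Ω y)
    (hw0 : Integrable fun y => (L ^ 2 + y ^ 2) * Ω y ^ 2)
    (hw1 : Integrable fun y => (L ^ 2 + y ^ 2) * deriv Ω y ^ 2)
    (hG : ∀ X, Ω X + 1 / 2 * X * deriv Ω X + a * (∫ s in (0 : ℝ)..X, hilbertTransform Ω s) * deriv Ω X
      - hilbertTransform Ω X * Ω X - ν * iteratedDeriv 2 Ω X = 0)
    (hv : v = fun ξ => Ω ξ + 1 / 2 * ξ * deriv Ω ξ) :
    (∀ y, v (-y) = -v y) ∧ (Integrable fun y => (L ^ 2 + y ^ 2) * v y ^ 2) ∧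
      Integrable fun y => (L ^ 2 + y ^ 2) * deriv v y ^ 2 := by
  have hΩ3 := contDiff_three hL hν.ne' hΩ hw0 hw1 hG
  obtain ⟨h2, h2'⟩ := weighted_level_two hL hν hΩ hodd hw0 hw1 hG
  have hΩ'c : Continuous (deriv Ω) := hΩ.continuous_deriv (by norm_num)
  have hΩ''c : Continuous (deriv (deriv Ω)) :=
    ((contDiff_succ_iff_deriv.1 (hΩ : ContDiff ℝ (1 + 1) Ω)).2.2).continuous_deriv le_rfl
  subst hv
  refine ⟨fun y => ?_, ?_, ?_⟩
  · simp only [deriv_even_of_odd hodd, hodd]; ring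
  · have hm : AEStronglyMeasurable (fun y => (L ^ 2 + y ^ 2) * (Ω y + 1 / 2 * y * deriv Ω y) ^ 2) volume :=
      Continuous.aestronglyMeasurable (by have := hΩ.continuous; fun_prop)
    refine ((hw0.const_mul 2).add (h2.const_mul ((L ^ 2 + 1) / 2))).mono' hm (Eventually.of_forall fun y => ?_)
    rw [Real.norm_eq_abs, abs_of_nonneg (by positivity)]
    simp only [Pi.add_apply]
    have hsq : (Ω y + 1 / 2 * y * deriv Ω y) ^ 2 ≤ 2 * Ω y ^ 2 + 1 / 2 * (y ^ 2 * deriv Ω y ^ 2) := by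
      nlinarith [sq_nonneg (Ω y - 1 / 2 * y * deriv Ω y)]
    have hwt : (L ^ 2 + y ^ 2) * y ^ 2 ≤ (L ^ 2 + 1) * (1 + y ^ 2) ^ 2 := by
      nlinarith [sq_nonneg y, sq_nonneg L, mul_nonneg (sq_nonneg L) (sq_nonneg y),
        mul_nonneg (sq_nonneg y) (sq_nonneg y)]
    have hw : 0 ≤ L ^ 2 + y ^ 2 := by positivity
    calc (L ^ 2 + y ^ 2) * (Ω y + 1 / 2 * y * deriv Ω y) ^ 2
        ≤ (L ^ 2 + y ^ 2) * (2 * Ω y ^ 2 + 1 / 2 * (y ^ 2 * deriv Ω y ^ 2)) := by gcongr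
      _ = 2 * ((L ^ 2 + y ^ 2) * Ω y ^ 2) + 1 / 2 * (((L ^ 2 + y ^ 2) * y ^ 2) * deriv Ω y ^ 2) := by ring
      _ ≤ 2 * ((L ^ 2 + y ^ 2) * Ω y ^ 2) + 1 / 2 * (((L ^ 2 + 1) * (1 + y ^ 2) ^ 2) * deriv Ω y ^ 2) := by
          gcongr
      _ = 2 * ((L ^ 2 + y ^ 2) * Ω y ^ 2) + (L ^ 2 + 1) / 2 * ((1 + y ^ 2) ^ 2 * deriv Ω y ^ 2) := by ring
  · rw [SheetRTimeShiftMode.deriv_timeShiftMode hΩ3]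
    have hm : AEStronglyMeasurable
        (fun y => (L ^ 2 + y ^ 2) * (3 / 2 * deriv Ω y + 1 / 2 * y * deriv (deriv Ω) y) ^ 2) volume :=
      Continuous.aestronglyMeasurable (by fun_prop)
    refine ((hw1.const_mul (9 / 2)).add (h2'.const_mul ((L ^ 2 + 1) / 2))).mono' hm
      (Eventually.of_forall fun y => ?_)
    rw [Real.norm_eq_abs, abs_of_nonneg (by positivity)]
    simp only [Pi.add_apply]
    have hsq : (3 / 2 * deriv Ω y + 1 / 2 * y * deriv (deriv Ω) y) ^ 2 ≤
        9 / 2 * deriv Ω y ^ 2 + 1 / 2 * (y ^ 2 * deriv (deriv Ω) y ^ 2) := by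
      nlinarith [sq_nonneg (3 / 2 * deriv Ω y - 1 / 2 * y * deriv (deriv Ω) y)]
    have hwt : (L ^ 2 + y ^ 2) * y ^ 2 ≤ (L ^ 2 + 1) * (1 + y ^ 2) ^ 2 := by
      nlinarith [sq_nonneg y, sq_nonneg L, mul_nonneg (sq_nonneg L) (sq_nonneg y),
        mul_nonneg (sq_nonneg y) (sq_nonneg y)]
    have hw : 0 ≤ L ^ 2 + y ^ 2 := by positivity
    calc (L ^ 2 + y ^ 2) * (3 / 2 * deriv Ω y + 1 / 2 * y * deriv (deriv Ω) y) ^ 2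
        ≤ (L ^ 2 + y ^ 2) * (9 / 2 * deriv Ω y ^ 2 + 1 / 2 * (y ^ 2 * deriv (deriv Ω) y ^ 2)) := by gcongr
      _ = 9 / 2 * ((L ^ 2 + y ^ 2) * deriv Ω y ^ 2)
          + 1 / 2 * (((L ^ 2 + y ^ 2) * y ^ 2) * deriv (deriv Ω) y ^ 2) := by ring
      _ ≤ 9 / 2 * ((L ^ 2 + y ^ 2) * deriv Ω y ^ 2)
          + 1 / 2 * (((L ^ 2 + 1) * (1 + y ^ 2) ^ 2) * deriv (deriv Ω) y ^ 2) := by gcongr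
      _ = 9 / 2 * ((L ^ 2 + y ^ 2) * deriv Ω y ^ 2)
          + (L ^ 2 + 1) / 2 * ((1 + y ^ 2) ^ 2 * deriv (deriv Ω) y ^ 2) := by ring

end SheetRTimeShiftModeEnergy
end Summit.NavierStokesRegularity.OSWSelfSimilar

end
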